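/-
Copyright (c) 2026 the pub-hodgecm-mathlib formalisation cell (harness21).  Prover seat hodgecm-mathlib-K2E4-p10 (g7), Track B ∕ K2-LIT, h413 = `stmt-HodgeConjecture-24833`,
line `K2_E1_TraceFormulaBeta`, 5Res ROADCARD AMENDMENT #3 rung G8 (dealer K2E1-plan (g7) (272)∕(274)(iv)): the MATRIX twin of ★ C3 FILE 2 `chi_scattering_fe_cm_two` (rank one) —
the GLOBAL functional equation `M(1 − z; χʷ)·M(z; χ) = 1` of the `(χ,τ)` scattering MATRIX at any rank, from a χ-FAMILY of Bernstein–Lapid ball packages indexed by a basis of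
`V(χ, K′, ω)`, the χʷ-package of a dual datum, the swap identities and the global pieces.  Hypothesis-first on the package clauses (★ shapes); the level instantiation is FILE 2.
-/
import Summits.HodgeConjecture.HodgeConjecture.Theorems.K2E1ChiScatteringFunctionalEquationCMTwo     -- ★ C3 FILE 1 (K2E1-p13): `sum_coeff_smul_coeff_eq_of_packages_cm_two` (matrix, general `κ`); brings ★ FILE 0 and ★ (G1)
import Summits.HodgeConjecture.HodgeConjecture.Theorems.K2E1ChiEisensteinBallPackageCMTwoScalar     -- ★ X1_χ §2c (K2E1-p14): ball-package clause currency (statement only)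
import Summits.HodgeConjecture.HodgeConjecture.Theorems.K2E1BLXSystemPackageFinDimU                -- ★ 11b: `sum_proj_smulRight_apply`
import HarnessLib

/-!
# G8 — `K2E1ChiScatteringMatrixFunctionalEquationCMTwoGlobal`: THE GLOBAL MATRIX FUNCTIONAL EQUATION `Σ_k qc′_k(1 − z)·qc_{k,j}(z) = δ_{j j₀}` OF THE `(χ,τ)` SCATTERING
# COORDINATES OF `U(1,1)_{L∕L⁺}` AT ANY RANK — hypothesis-first on a χ-family of ball packages, the χʷ-package of the dual datum `j₀`, the swap identities and the global pieces

Track B ∕ K2-LIT, crux h413 = `stmt-HodgeConjecture-24833`, route of record `HCCMUnconditional`; cell `hodgecm-mathlib`, squad K2, ENGINE E1; AMENDMENT #3 rung G8 («matrix hFE M(z)M(1−z) = id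
from ★ C3 FILE 1, general κ»), dealer rulings (272)∕(274)(iv).  THEOREMS ONLY (no `def`, no `instance`, no `notation`, no named-fact hypothesis, no `sorry`; default heartbeats); lane
`--supports stmt-HodgeConjecture-24833 --as helper` (count-neutral).
THE MATHEMATICS ([BernsteinLapid2019, §4 Claims 2–5, §5]; [MoeglinWaldspurger1995, IV.1.8–IV.1.10]; [Langlands1976, §7]).  This is ★ `chi_scattering_fe_cm_two` with the rank-one
restriction `[Unique κ]` REMOVED.  Data: the common convolution data (`h_i` left-`K_U`-invariant, operators `T_i`), the ι-bound; (i) a χ-FAMILY of ball packages on `D_n` indexed by a basis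
`κ` of `V(χ, K′, ω)` — common holomorphy set `U` and column data `col_j` (`j ∈ ι′`, a basis of `V(χʷ, K′, ω′)`), per-`k` data `α₁ k`, solutions `(vX k, cc k)` with `cc k z ∈ ι′ → ℂ` = the
`k`-th COLUMN of `M(z; χ)`, the package equations for every `k` and UNIQUENESS at one datum `k₀` (★ X1_χ §2c clause shapes); (ii) the χʷ-package of the dual datum `φ′_{j₀}` on the same ball
(`U′`, `vX′`, `cc′ w ∈ κ → ℂ` = the `j₀`-th ROW data of `M(w; χʷ)`, `α₁′`, `col′_k`); (iii) the swap identities `α₁′(1 − z) = col_{j₀}(z)`, `col′_k(1 − z) = α₁ k z`; (iv) global pieces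
`qc k j`, `qc′ k` analytic off closed co-discrete `P`, `P′ ⊆ {Re ≤ 1}` agreeing with the ball coordinates on the tube.  THEN (§A) ★ C3 FILE 1 `sum_coeff_smul_coeff_eq_of_packages_cm_two`
gives `Σ_k cc′(1−z)_k • cc_k(z) = e_{j₀}` on `U ∩ (1 − U′)`; (§B) ★ FILE 0 `eqOn_diff_of_eqOn_re_gt` identifies every coordinate with its global piece off the poles; (§C) ★
`exists_mem_and_sub_mem` gives a base point; (§D) the entrywise identity `Σ_k qc′_k(1−z)·qc_{k,j}(z) = δ_{j j₀}` near the base point globalises off `P ∪ (1 − P′)` by §1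
`sum_mul_eq_of_eventually` (the finite-sum twin of ★ `mul_eq_one_of_eventually`).  Running `j₀` over `ι′` gives the full `M(1 − z; χʷ)·M(z; χ) = 1`; for self-dual `χ` in one basis this
is the `hmFE` letter of ★ p860910 `hFE_of_coords` (G8 FILE 1).
* §1 **`sum_mul_eq_of_eventually`** (generic complex analysis: `Σ_k c′_k(ρ − z)·c_k(z) = d` near one point ⟹ off `P ∪ (ρ − P′)`).
* §2 HEAD **`chi_scattering_matrix_fe_cm_two`**.
HONEST LABEL: HC_CM is proved only modulo the 7 printed citations (2 remaining named inputs: hLiu418 = `stmt-HodgeConjecture-24832`, h413 = `stmt-HodgeConjecture-24833`) until rung 0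
closes; this file asserts no named fact, is hypothesis-first on the package clauses, and closes no socket; count-neutral.

## References
* [BernsteinLapid2019] J. Bernstein, E. Lapid, *On the meromorphic continuation of Eisenstein series*, J. AMS 37 (2024), §4 Claims 2–5, §5.
* [MoeglinWaldspurger1995] C. Mœglin, J.-L. Waldspurger, *Spectral decomposition and Eisenstein series* (1995), IV.1.8–IV.1.10.
* [Langlands1976] R. P. Langlands, *On the Functional Equations Satisfied by Eisenstein Series*, LNM 544 (1976), §7.
-/

set_option autoImplicit false
set_option linter.dupNamespace false  -- the mandated namespace repeats the summit's segment (`HodgeConjecture.HodgeConjecture`)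

noncomputable section

open MeasureTheory Filter Topology Set NumberField
open scoped NNReal ENNReal BigOperators
open Literature.NumberTheory.Automorphic Literature.NumberTheory.Automorphic.UnitaryGroup AdelicGroupData
open Summit.HodgeConjecture.HodgeConjecture.Cruxes.H413.K2E1BorelEisensteinU
open Summit.HodgeConjecture.HodgeConjecture.Cruxes.H413.K2E1BLBorelSpacesU2Defs
open Summit.HodgeConjecture.HodgeConjecture.Cruxes.H413.K2E1BLBorelOperatorsU2Defs
open Summit.HodgeConjecture.HodgeConjecture.Cruxes.H413.K2E1BLXSystemPackageFinDimU (sum_proj_smulRight_apply)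
open Summit.HodgeConjecture.HodgeConjecture.Cruxes.H413.K2E1ScatteringFunctionalEquationOfUnique (eqOn_diff_of_eqOn_re_gt exists_mem_and_sub_mem)
open Summit.HodgeConjecture.HodgeConjecture.Cruxes.H413.K2E1ConvexDiffCountableConnected (isPreconnected_convex_diff_of_countable countable_of_codiscrete)
open Summit.HodgeConjecture.HodgeConjecture.Cruxes.H413.K2E1ChiScatteringFunctionalEquationCMTwo (sum_coeff_smul_coeff_eq_of_packages_cm_two)

namespace Summit.HodgeConjecture.HodgeConjecture.Cruxes.H413.K2E1ChiScatteringMatrixFunctionalEquationCMTwoGlobal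

/-! ## §1 Globalisation of a finite-sum identity off the pole sets (generic complex analysis) -/

/-- **GLOBALISATION OF `Σ_k c′_k(ρ − z)·c_k(z) = d` OFF THE POLE SETS** (finite-sum twin of ★ `mul_eq_one_of_eventually`): `c_k` analytic off a countable `P`, `c′_k` analytic off a countable
`P′`, the identity on a neighbourhood of one point ⟹ the identity for all `z ∉ P` with `ρ − z ∉ P′` (`ℂ ∖ (P ∪ (ρ − P′))` is preconnected — ★ `isPreconnected_convex_diff_of_countable` — and
the identity theorem applies). [cite: MoeglinWaldspurger1995, IV.1.10] [cite: BernsteinLapid2019, §5] -/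
theorem sum_mul_eq_of_eventually {κ : Type*} [Fintype κ] {P P' : Set ℂ} {c c' : κ → ℂ → ℂ} (ρ d : ℂ) (hPcount : P.Countable) (hP'count : P'.Countable)
    (hc : ∀ k (z : ℂ), z ∉ P → AnalyticAt ℂ (c k) z) (hc' : ∀ k (z : ℂ), z ∉ P' → AnalyticAt ℂ (c' k) z)
    {z₀ : ℂ} (hloc : ∀ᶠ z in 𝓝 z₀, ∑ k, c' k (ρ - z) * c k z = d) :
    ∀ z : ℂ, z ∉ P → ρ - z ∉ P' → ∑ k, c' k (ρ - z) * c k z = d := by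
  have hcount : (P ∪ (fun z : ℂ => ρ - z) ⁻¹' P').Countable := hPcount.union (hP'count.preimage sub_right_injective)
  have hpre : IsPreconnected (univ \ (P ∪ (fun z : ℂ => ρ - z) ⁻¹' P')) :=
    isPreconnected_convex_diff_of_countable Literature.Topology.Euclidean.one_lt_rank_real_complex convex_univ isOpen_univ hcount
  have hfan : AnalyticOnNhd ℂ (fun z => ∑ k, c' k (ρ - z) * c k z) (univ \ (P ∪ (fun z : ℂ => ρ - z) ⁻¹' P')) := fun z hz =>
    Finset.analyticAt_fun_sum _ fun k _ => (((hc' k (ρ - z) fun h => hz.2 (Or.inr h)).comp (analyticAt_const.sub analyticAt_id)).mul (hc k z fun h => hz.2 (Or.inl h)))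
  obtain ⟨V, hVloc, hVo, hz₀V⟩ := eventually_nhds_iff.1 hloc
  have hdense : Dense (P ∪ (fun z : ℂ => ρ - z) ⁻¹' P')ᶜ := hcount.dense_compl ℂ
  obtain ⟨z₁, hz₁V, hz₁⟩ := hdense.inter_open_nonempty V hVo ⟨z₀, hz₀V⟩
  have hev : (fun z => ∑ k, c' k (ρ - z) * c k z) =ᶠ[𝓝 z₁] fun _ => d := by
    filter_upwards [hVo.mem_nhds hz₁V] with z hz
    exact hVloc z hz
  have hEq := hfan.eqOn_of_preconnected_of_eventuallyEq analyticOnNhd_const hpre ⟨mem_univ z₁, hz₁⟩ hev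
  exact fun z hzP hzP' => hEq ⟨mem_univ z, by rintro (h | h); exacts [hzP h, hzP' h]⟩

/-! ## §2 The global matrix functional equation of the `(χ,τ)` scattering coordinates of `U(1,1)_{L∕L⁺}` -/

variable (L : Type) [Field L] [NumberField L] [IsCMField L]
  [MeasurableSpace (quasiSplit (↥(maximalRealSubfield L)) L (IsCMField.complexConj L) 2).Adelic] [BorelSpace (quasiSplit (↥(maximalRealSubfield L)) L (IsCMField.complexConj L) 2).Adelic]

/-- **HEAD — THE GLOBAL MATRIX FUNCTIONAL EQUATION `Σ_k qc′_k(1 − z)·qc_{k,j}(z) = δ_{j j₀}` OF THE `(χ,τ)` SCATTERING COORDINATES AT ANY RANK** (module docstring): the `j₀`-th row of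
`M(1 − z; χʷ)·M(z; χ) = 1`, off `P ∪ (1 − P′)`, from (i) the χ-family of ball packages indexed by the basis `κ` of `V(χ)` (common `U`, columns `col_j`, uniqueness at `k₀`), (ii) the
χʷ-package of the dual datum `j₀`, (iii) the swap identities, (iv) the global pieces and their tube agreement.  ★ `chi_scattering_fe_cm_two` is the case `κ` a singleton.
[cite: BernsteinLapid2019, §4 Claims 2–5 and §5] [cite: MoeglinWaldspurger1995, IV.1.8–IV.1.10] [cite: Langlands1976, §7] -/
theorem chi_scattering_matrix_fe_cm_two
    {μ : Measure (quasiSplit (↥(maximalRealSubfield L)) L (IsCMField.complexConj L) 2).automorphicQuotient}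
    (νG : Measure (quasiSplit (↥(maximalRealSubfield L)) L (IsCMField.complexConj L) 2).Adelic) [νG.IsHaarMeasure]
    {n : ℕ} {a : ℝ≥0} {μZ : Measure (borelQuotient (↥(maximalRealSubfield L)) L (IsCMField.complexConj L) 2)}
    (hb : IotaBound (↥(maximalRealSubfield L)) L (IsCMField.complexConj L) 2 (n + 3) a μ μZ)
    -- the common convolution data: left-`K_U`-invariant test functions `h_i ∈ C_c(G(𝔸))` and the operators `T_i`
    {I : Type} {h : I → (quasiSplit (↥(maximalRealSubfield L)) L (IsCMField.complexConj L) 2).Adelic → ℂ}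
    (hK : ∀ i, ∀ k₁ : (quasiSplit (↥(maximalRealSubfield L)) L (IsCMField.complexConj L) 2).Adelic,
      adelicVal (↥(maximalRealSubfield L)) L (IsCMField.complexConj L) 2 ((StdForm.antidiagonal 2).over L) k₁ ∈ standardMaximalCompactGL 2 L → ∀ x, h i (k₁ * x) = h i x)
    (hh : ∀ i, Continuous (h i)) (hhs : ∀ i, HasCompactSupport (h i))
    (T : I → HX (↥(maximalRealSubfield L)) L (IsCMField.complexConj L) 2 (n + 3) μ →L[ℂ] HX (↥(maximalRealSubfield L)) L (IsCMField.complexConj L) 2 (n + 3) μ)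
    -- (i) the χ-FAMILY of ball packages on `D_n` indexed by the basis `κ` of `V(χ)`: common `U` and columns `col_j` (`j ∈ ι′`), data `α₁ k`, solutions `(vX k, cc k)`, uniqueness at `k₀`
    {ι' : Type} [Fintype ι'] [DecidableEq ι'] (j₀ : ι') {κ : Type} [Fintype κ] (k₀ : κ)
    {U : Set ℂ} (hUo : IsOpen U) (hUD : U ⊆ Metric.ball (0 : ℂ) (n + 2)) (hUcd : ∀ z₀ ∈ Metric.ball (0 : ℂ) (n + 2), ∀ᶠ s in 𝓝[≠] z₀, s ∈ U)
    {vX : κ → ℂ → HX (↥(maximalRealSubfield L)) L (IsCMField.complexConj L) 2 (n + 3) μ} {cc : κ → ℂ → ι' → ℂ} (hccd : ∀ k, DifferentiableOn ℂ (cc k) U)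
    {α₁ : κ → ℂ → HN (↥(maximalRealSubfield L)) L (IsCMField.complexConj L) 2 (n + 3) a μZ} {col : ι' → ℂ → HN (↥(maximalRealSubfield L)) L (IsCMField.complexConj L) 2 (n + 3) a μZ}
    (heqs : ∀ k, ∀ z ∈ U, (∀ i, T i (vX k z) = (∫ x, h i x * (((borelHeight x : ℝ≥0) : ℝ) : ℂ) ^ z ∂νG) • vX k z) ∧
      cnstN (↥(maximalRealSubfield L)) L (IsCMField.complexConj L) 2 (n + 3) a μZ (iota hb (vX k z)) = (1 : ℂ) • α₁ k z + (∑ j, (ContinuousLinearMap.proj (R := ℂ) (φ := fun _ : ι' => ℂ) j).smulRight (col j z) : (ι' → ℂ) →L[ℂ] HN (↥(maximalRealSubfield L)) L (IsCMField.complexConj L) 2 (n + 3) a μZ) (cc k z))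
    (huniq : ∀ z ∈ U, ∀ (ψ : HX (↥(maximalRealSubfield L)) L (IsCMField.complexConj L) 2 (n + 3) μ) (b : ι' → ℂ), (∀ i, T i ψ = (∫ x, h i x * (((borelHeight x : ℝ≥0) : ℝ) : ℂ) ^ z ∂νG) • ψ) →
      cnstN (↥(maximalRealSubfield L)) L (IsCMField.complexConj L) 2 (n + 3) a μZ (iota hb ψ) = (1 : ℂ) • α₁ k₀ z + (∑ j, (ContinuousLinearMap.proj (R := ℂ) (φ := fun _ : ι' => ℂ) j).smulRight (col j z) : (ι' → ℂ) →L[ℂ] HN (↥(maximalRealSubfield L)) L (IsCMField.complexConj L) 2 (n + 3) a μZ) b →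
        ψ = vX k₀ z ∧ b = cc k₀ z)
    -- (ii) the χʷ-ball package of the dual datum `φ′_{j₀}` on the same ball ∕ weight ∕ level (columns indexed by the basis `κ` of `V(χ)`)
    {U' : Set ℂ} (hU'o : IsOpen U') (hU'D : U' ⊆ Metric.ball (0 : ℂ) (n + 2)) (hU'cd : ∀ z₀ ∈ Metric.ball (0 : ℂ) (n + 2), ∀ᶠ s in 𝓝[≠] z₀, s ∈ U')
    {vX' : ℂ → HX (↥(maximalRealSubfield L)) L (IsCMField.complexConj L) 2 (n + 3) μ} {cc' : ℂ → κ → ℂ} (hcc'd : DifferentiableOn ℂ cc' U')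
    {α₁' : ℂ → HN (↥(maximalRealSubfield L)) L (IsCMField.complexConj L) 2 (n + 3) a μZ} {col' : κ → ℂ → HN (↥(maximalRealSubfield L)) L (IsCMField.complexConj L) 2 (n + 3) a μZ}
    (heqs' : ∀ w ∈ U', (∀ i, T i (vX' w) = (∫ x, h i x * (((borelHeight x : ℝ≥0) : ℝ) : ℂ) ^ w ∂νG) • vX' w) ∧
      cnstN (↥(maximalRealSubfield L)) L (IsCMField.complexConj L) 2 (n + 3) a μZ (iota hb (vX' w)) = (1 : ℂ) • α₁' w + (∑ k, (ContinuousLinearMap.proj (R := ℂ) (φ := fun _ : κ => ℂ) k).smulRight (col' k w) : (κ → ℂ) →L[ℂ] HN (↥(maximalRealSubfield L)) L (IsCMField.complexConj L) 2 (n + 3) a μZ) (cc' w))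
    -- (iii) the swap identities in `𝓗_k(Z_a)` (`Lp.ext` of the packages' a.e. clauses)
    (hsw₁ : ∀ z ∈ U, 1 - z ∈ U' → α₁' (1 - z) = col j₀ z) (hsw₂ : ∀ z ∈ U, 1 - z ∈ U' → ∀ k, col' k (1 - z) = α₁ k z)
    -- (iv) the global coefficient pieces (★ X2_χ ∕ ★ p860855 clause shapes) and their tube agreement with the ball coordinates
    {P P' : Set ℂ} {qc : κ → ι' → ℂ → ℂ} {qc' : κ → ℂ → ℂ}
    (hPc : IsClosed P) (hPcd : ∀ z₀ : ℂ, ∀ᶠ s in 𝓝[≠] z₀, s ∉ P) (hPre : ∀ z ∈ P, z.re ≤ 1) (hqa : ∀ k j (z : ℂ), z ∉ P → AnalyticAt ℂ (qc k j) z)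
    (hP'c : IsClosed P') (hP'cd : ∀ z₀ : ℂ, ∀ᶠ s in 𝓝[≠] z₀, s ∉ P') (hP're : ∀ z ∈ P', z.re ≤ 1) (hq'a : ∀ k (z : ℂ), z ∉ P' → AnalyticAt ℂ (qc' k) z)
    (hagree : ∀ k j, ∀ z ∈ U, 1 < z.re → cc k z j = qc k j z) (hagree' : ∀ k, ∀ w ∈ U', 1 < w.re → cc' w k = qc' k w) :
    ∀ z : ℂ, z ∉ P → 1 - z ∉ P' → ∀ j, ∑ k, qc' k (1 - z) * qc k j z = if j = j₀ then 1 else 0 := by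
  classical
  -- §A the column functional equation on `U ∩ (1 − U′)` (★ C3 FILE 1 §2, `u′ = Pi.single j₀ 1`), read entrywise
  have hLu : ∀ z, (∑ j, (ContinuousLinearMap.proj (R := ℂ) (φ := fun _ : ι' => ℂ) j).smulRight (col j z) : (ι' → ℂ) →L[ℂ] HN (↥(maximalRealSubfield L)) L (IsCMField.complexConj L) 2 (n + 3) a μZ) (Pi.single j₀ (1 : ℂ)) = col j₀ z := fun z => by
    rw [sum_proj_smulRight_apply, Finset.sum_eq_single j₀ (fun j _ hj => by rw [Pi.single_eq_of_ne hj, zero_smul]) (fun hj => (hj (Finset.mem_univ j₀)).elim),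
      Pi.single_eq_same, one_smul]
  have hFEvec : ∀ z ∈ U, 1 - z ∈ U' → ∑ k, cc' (1 - z) k • cc k z = Pi.single j₀ (1 : ℂ) :=
    sum_coeff_smul_coeff_eq_of_packages_cm_two L νG hK hh hhs T
      ((cnstN (↥(maximalRealSubfield L)) L (IsCMField.complexConj L) 2 (n + 3) a μZ).comp (iota hb))
      (0 : HX (↥(maximalRealSubfield L)) L (IsCMField.complexConj L) 2 (n + 3) μ →L[ℂ] HX (↥(maximalRealSubfield L)) L (IsCMField.complexConj L) 2 (n + 3) μ)
      α₁ (fun z => (∑ j, (ContinuousLinearMap.proj (R := ℂ) (φ := fun _ : ι' => ℂ) j).smulRight (col j z) : (ι' → ℂ) →L[ℂ] HN (↥(maximalRealSubfield L)) L (IsCMField.complexConj L) 2 (n + 3) a μZ))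
      vX cc
      (fun k z hz => ⟨(heqs k z hz).1, by simpa only [ContinuousLinearMap.comp_apply] using (heqs k z hz).2, rfl⟩)
      k₀ (fun z hz ψ b hT hC _ => huniq z hz ψ b hT (by simpa only [ContinuousLinearMap.comp_apply] using hC))
      α₁' (fun w => (∑ k, (ContinuousLinearMap.proj (R := ℂ) (φ := fun _ : κ => ℂ) k).smulRight (col' k w) : (κ → ℂ) →L[ℂ] HN (↥(maximalRealSubfield L)) L (IsCMField.complexConj L) 2 (n + 3) a μZ)) vX' cc'
      (fun w hw => ⟨(heqs' w hw).1, by simpa only [ContinuousLinearMap.comp_apply] using (heqs' w hw).2, rfl⟩)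
      (Pi.single j₀ (1 : ℂ)) (fun z hz hz' => by rw [hLu]; exact hsw₁ z hz hz')
      (fun z hz hz' b' => by rw [sum_proj_smulRight_apply]; exact Finset.sum_congr rfl fun k _ => by rw [hsw₂ z hz hz' k])
  have hFEloc : ∀ z ∈ U, 1 - z ∈ U' → ∀ j, ∑ k, cc' (1 - z) k * cc k z j = if j = j₀ then 1 else 0 := fun z hz hz' j => by
    have key := congr_fun (hFEvec z hz hz') j
    rw [Finset.sum_apply] at key
    simpa only [Pi.smul_apply, smul_eq_mul, Pi.single_apply] using key
  -- §B identification of the ball coordinates with the global pieces on `U ∖ P`, `U′ ∖ P′` (★ FILE 0 §2; base point `3∕2 ∈ D_n`)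
  have h32 : (((3 / 2 : ℝ)) : ℂ) ∈ Metric.ball (0 : ℂ) (n + 2) := by
    rw [mem_ball_zero_iff, Complex.norm_real, Real.norm_eq_abs, abs_of_pos (by norm_num : (0 : ℝ) < 3 / 2)]
    have h0 : (0 : ℝ) ≤ n := Nat.cast_nonneg n
    linarith
  have h32re : (1 : ℝ) < ((((3 / 2 : ℝ)) : ℂ)).re := by rw [Complex.ofReal_re]; norm_num
  have hid : ∀ k j, ∀ z ∈ U, z ∉ P → cc k z j = qc k j z := fun k j =>
    eqOn_diff_of_eqOn_re_gt (f := fun z => cc k z j) hUo hUD hUcd (differentiableOn_pi.1 (hccd k) j) hPc (countable_of_codiscrete hPcd) hPre (fun z _ hz => hqa k j z hz) h32 h32re (hagree k j)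
  have hid' : ∀ k, ∀ w ∈ U', w ∉ P' → cc' w k = qc' k w := fun k =>
    eqOn_diff_of_eqOn_re_gt (f := fun w => cc' w k) hU'o hU'D hU'cd (differentiableOn_pi.1 hcc'd k) hP'c (countable_of_codiscrete hP'cd) hP're (fun z _ hz => hq'a k z hz) h32 h32re (hagree' k)
  -- §C a base point `z₀ ∈ U ∖ P` with `1 − z₀ ∈ U′ ∖ P′` (★ FILE 0 §3 at `½`)
  have hhalf : (((1 / 2 : ℝ)) : ℂ) ∈ Metric.ball (0 : ℂ) (n + 2) := by
    rw [mem_ball_zero_iff, Complex.norm_real, Real.norm_eq_abs, abs_of_pos (by norm_num : (0 : ℝ) < 1 / 2)]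
    have h0 : (0 : ℝ) ≤ n := Nat.cast_nonneg n
    linarith
  have hhalf' : (1 : ℂ) - (((1 / 2 : ℝ)) : ℂ) = (((1 / 2 : ℝ)) : ℂ) := by push_cast; ring
  obtain ⟨z₀, ⟨hz₀U, hz₀P⟩, h1z₀U, h1z₀P⟩ := exists_mem_and_sub_mem (U := U) (U' := U') (P := P) (P' := P') 1 ((((1 / 2 : ℝ)) : ℂ))
    (hUcd _ hhalf) (hPcd _) (by rw [hhalf']; exact hU'cd _ hhalf) (by rw [hhalf']; exact hP'cd _)
  -- §D the entrywise identity near `z₀`, then everywhere off `P ∪ (1 − P′)` (§1)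
  intro z hz hz' j
  have hloc : ∀ᶠ s in 𝓝 z₀, ∑ k, qc' k (1 - s) * qc k j s = if j = j₀ then 1 else 0 := by
    have hc1 : ContinuousAt (fun s : ℂ => 1 - s) z₀ := (continuous_const.sub continuous_id).continuousAt
    filter_upwards [hUo.mem_nhds hz₀U, hPc.isOpen_compl.mem_nhds hz₀P, hc1.eventually_mem (hU'o.mem_nhds h1z₀U),
      hc1.eventually_mem (hP'c.isOpen_compl.mem_nhds h1z₀P)] with s hsU hsP h1U h1P
    rw [← hFEloc s hsU h1U j]
    exact Finset.sum_congr rfl fun k _ => by rw [← hid k j s hsU hsP, ← hid' k (1 - s) h1U h1P]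
  exact sum_mul_eq_of_eventually 1 (if j = j₀ then 1 else 0) (countable_of_codiscrete hPcd) (countable_of_codiscrete hP'cd) (fun k s hs => hqa k j s hs) hq'a hloc z hz hz'

/-! ## §3 (ED. 2) The generic-eigenvalue edition (symmetry of the Hecke eigenvalues as a letter) -/

omit [BorelSpace (quasiSplit (↥(maximalRealSubfield L)) L (IsCMField.complexConj L) 2).Adelic] in
/-- **(ED. 2) GENERIC-EIGENVALUE EDITION of the HEAD** — the Hecke scalars are ENTIRE eigenvalue functions `ŝ_i(z)` (★ K2-defs1's eigen packages p860811 ∕ level convData ★ p860739: arch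
gauge test functions with `χ`-twisted symbols) instead of the spherical transforms `∫ h_i·H^z dν_G`, and their symmetry `ŝ_i(1 − z) = ŝ_i(z)` is a VISIBLE letter `hsym` (= `hsymm_τ`, ★ p860867 ∕
★ p860913 at general `(χ_∞, ω)`; ★ (G1) at the trivial `K_∞`-type).  Same conclusion; ★ C3 FILE 1 §1 `sum_coeff_smul_coeff_eq_of_packages` (abstract) in §A.  This is the edition the LEVEL
instantiation (G8 STEP 2) consumes. [cite: BernsteinLapid2019, §4 Claims 2–5 and §5] [cite: MoeglinWaldspurger1995, IV.1.8–IV.1.10] [cite: Langlands1976, §7] -/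
theorem chi_scattering_matrix_fe_cm_two_of_eigen
    {μ : Measure (quasiSplit (↥(maximalRealSubfield L)) L (IsCMField.complexConj L) 2).automorphicQuotient}
    (νG : Measure (quasiSplit (↥(maximalRealSubfield L)) L (IsCMField.complexConj L) 2).Adelic) [νG.IsHaarMeasure]
    {n : ℕ} {a : ℝ≥0} {μZ : Measure (borelQuotient (↥(maximalRealSubfield L)) L (IsCMField.complexConj L) 2)}
    (hb : IotaBound (↥(maximalRealSubfield L)) L (IsCMField.complexConj L) 2 (n + 3) a μ μZ)
    -- the common eigen data: entire eigenvalue functions `ŝ_i` with the symmetry letter, and the operators `T_i`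
    {I : Type} (ŝ : I → ℂ → ℂ) (hsym : ∀ i z, ŝ i (1 - z) = ŝ i z)
    (T : I → HX (↥(maximalRealSubfield L)) L (IsCMField.complexConj L) 2 (n + 3) μ →L[ℂ] HX (↥(maximalRealSubfield L)) L (IsCMField.complexConj L) 2 (n + 3) μ)
    -- (i) the χ-FAMILY of ball packages on `D_n` indexed by the basis `κ` of `V(χ)`: common `U` and columns `col_j` (`j ∈ ι′`), data `α₁ k`, solutions `(vX k, cc k)`, uniqueness at `k₀`
    {ι' : Type} [Fintype ι'] [DecidableEq ι'] (j₀ : ι') {κ : Type} [Fintype κ] (k₀ : κ)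
    {U : Set ℂ} (hUo : IsOpen U) (hUD : U ⊆ Metric.ball (0 : ℂ) (n + 2)) (hUcd : ∀ z₀ ∈ Metric.ball (0 : ℂ) (n + 2), ∀ᶠ s in 𝓝[≠] z₀, s ∈ U)
    {vX : κ → ℂ → HX (↥(maximalRealSubfield L)) L (IsCMField.complexConj L) 2 (n + 3) μ} {cc : κ → ℂ → ι' → ℂ} (hccd : ∀ k, DifferentiableOn ℂ (cc k) U)
    {α₁ : κ → ℂ → HN (↥(maximalRealSubfield L)) L (IsCMField.complexConj L) 2 (n + 3) a μZ} {col : ι' → ℂ → HN (↥(maximalRealSubfield L)) L (IsCMField.complexConj L) 2 (n + 3) a μZ}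
    (heqs : ∀ k, ∀ z ∈ U, (∀ i, T i (vX k z) = ŝ i z • vX k z) ∧
      cnstN (↥(maximalRealSubfield L)) L (IsCMField.complexConj L) 2 (n + 3) a μZ (iota hb (vX k z)) = (1 : ℂ) • α₁ k z + (∑ j, (ContinuousLinearMap.proj (R := ℂ) (φ := fun _ : ι' => ℂ) j).smulRight (col j z) : (ι' → ℂ) →L[ℂ] HN (↥(maximalRealSubfield L)) L (IsCMField.complexConj L) 2 (n + 3) a μZ) (cc k z))
    (huniq : ∀ z ∈ U, ∀ (ψ : HX (↥(maximalRealSubfield L)) L (IsCMField.complexConj L) 2 (n + 3) μ) (b : ι' → ℂ), (∀ i, T i ψ = ŝ i z • ψ) →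
      cnstN (↥(maximalRealSubfield L)) L (IsCMField.complexConj L) 2 (n + 3) a μZ (iota hb ψ) = (1 : ℂ) • α₁ k₀ z + (∑ j, (ContinuousLinearMap.proj (R := ℂ) (φ := fun _ : ι' => ℂ) j).smulRight (col j z) : (ι' → ℂ) →L[ℂ] HN (↥(maximalRealSubfield L)) L (IsCMField.complexConj L) 2 (n + 3) a μZ) b →
        ψ = vX k₀ z ∧ b = cc k₀ z)
    -- (ii) the χʷ-ball package of the dual datum `φ′_{j₀}` on the same ball ∕ weight ∕ level (columns indexed by the basis `κ` of `V(χ)`)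
    {U' : Set ℂ} (hU'o : IsOpen U') (hU'D : U' ⊆ Metric.ball (0 : ℂ) (n + 2)) (hU'cd : ∀ z₀ ∈ Metric.ball (0 : ℂ) (n + 2), ∀ᶠ s in 𝓝[≠] z₀, s ∈ U')
    {vX' : ℂ → HX (↥(maximalRealSubfield L)) L (IsCMField.complexConj L) 2 (n + 3) μ} {cc' : ℂ → κ → ℂ} (hcc'd : DifferentiableOn ℂ cc' U')
    {α₁' : ℂ → HN (↥(maximalRealSubfield L)) L (IsCMField.complexConj L) 2 (n + 3) a μZ} {col' : κ → ℂ → HN (↥(maximalRealSubfield L)) L (IsCMField.complexConj L) 2 (n + 3) a μZ}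
    (heqs' : ∀ w ∈ U', (∀ i, T i (vX' w) = ŝ i w • vX' w) ∧
      cnstN (↥(maximalRealSubfield L)) L (IsCMField.complexConj L) 2 (n + 3) a μZ (iota hb (vX' w)) = (1 : ℂ) • α₁' w + (∑ k, (ContinuousLinearMap.proj (R := ℂ) (φ := fun _ : κ => ℂ) k).smulRight (col' k w) : (κ → ℂ) →L[ℂ] HN (↥(maximalRealSubfield L)) L (IsCMField.complexConj L) 2 (n + 3) a μZ) (cc' w))
    -- (iii) the swap identities in `𝓗_k(Z_a)` (`Lp.ext` of the packages' a.e. clauses)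
    (hsw₁ : ∀ z ∈ U, 1 - z ∈ U' → α₁' (1 - z) = col j₀ z) (hsw₂ : ∀ z ∈ U, 1 - z ∈ U' → ∀ k, col' k (1 - z) = α₁ k z)
    -- (iv) the global coefficient pieces (★ X2_χ ∕ ★ p860855 clause shapes) and their tube agreement with the ball coordinates
    {P P' : Set ℂ} {qc : κ → ι' → ℂ → ℂ} {qc' : κ → ℂ → ℂ}
    (hPc : IsClosed P) (hPcd : ∀ z₀ : ℂ, ∀ᶠ s in 𝓝[≠] z₀, s ∉ P) (hPre : ∀ z ∈ P, z.re ≤ 1) (hqa : ∀ k j (z : ℂ), z ∉ P → AnalyticAt ℂ (qc k j) z)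
    (hP'c : IsClosed P') (hP'cd : ∀ z₀ : ℂ, ∀ᶠ s in 𝓝[≠] z₀, s ∉ P') (hP're : ∀ z ∈ P', z.re ≤ 1) (hq'a : ∀ k (z : ℂ), z ∉ P' → AnalyticAt ℂ (qc' k) z)
    (hagree : ∀ k j, ∀ z ∈ U, 1 < z.re → cc k z j = qc k j z) (hagree' : ∀ k, ∀ w ∈ U', 1 < w.re → cc' w k = qc' k w) :
    ∀ z : ℂ, z ∉ P → 1 - z ∉ P' → ∀ j, ∑ k, qc' k (1 - z) * qc k j z = if j = j₀ then 1 else 0 := by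
  classical
  -- §A the column functional equation on `U ∩ (1 − U′)` (★ C3 FILE 1 §1 abstract, `u′ = Pi.single j₀ 1`), read entrywise
  have hLu : ∀ z, (∑ j, (ContinuousLinearMap.proj (R := ℂ) (φ := fun _ : ι' => ℂ) j).smulRight (col j z) : (ι' → ℂ) →L[ℂ] HN (↥(maximalRealSubfield L)) L (IsCMField.complexConj L) 2 (n + 3) a μZ) (Pi.single j₀ (1 : ℂ)) = col j₀ z := fun z => by
    rw [sum_proj_smulRight_apply, Finset.sum_eq_single j₀ (fun j _ hj => by rw [Pi.single_eq_of_ne hj, zero_smul]) (fun hj => (hj (Finset.mem_univ j₀)).elim),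
      Pi.single_eq_same, one_smul]
  have hFEvec : ∀ z ∈ U, 1 - z ∈ U' → ∑ k, cc' (1 - z) k • cc k z = Pi.single j₀ (1 : ℂ) :=
    Summit.HodgeConjecture.HodgeConjecture.Cruxes.H413.K2E1ChiScatteringFunctionalEquationCMTwo.sum_coeff_smul_coeff_eq_of_packages 1 T ŝ hsym
      ((cnstN (↥(maximalRealSubfield L)) L (IsCMField.complexConj L) 2 (n + 3) a μZ).comp (iota hb))
      (0 : HX (↥(maximalRealSubfield L)) L (IsCMField.complexConj L) 2 (n + 3) μ →L[ℂ] HX (↥(maximalRealSubfield L)) L (IsCMField.complexConj L) 2 (n + 3) μ)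
      α₁ (fun z => (∑ j, (ContinuousLinearMap.proj (R := ℂ) (φ := fun _ : ι' => ℂ) j).smulRight (col j z) : (ι' → ℂ) →L[ℂ] HN (↥(maximalRealSubfield L)) L (IsCMField.complexConj L) 2 (n + 3) a μZ))
      vX cc
      (fun k z hz => ⟨(heqs k z hz).1, by simpa only [ContinuousLinearMap.comp_apply] using (heqs k z hz).2, rfl⟩)
      k₀ (fun z hz ψ b hT hC _ => huniq z hz ψ b hT (by simpa only [ContinuousLinearMap.comp_apply] using hC))
      α₁' (fun w => (∑ k, (ContinuousLinearMap.proj (R := ℂ) (φ := fun _ : κ => ℂ) k).smulRight (col' k w) : (κ → ℂ) →L[ℂ] HN (↥(maximalRealSubfield L)) L (IsCMField.complexConj L) 2 (n + 3) a μZ)) vX' cc'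
      (fun w hw => ⟨(heqs' w hw).1, by simpa only [ContinuousLinearMap.comp_apply] using (heqs' w hw).2, rfl⟩)
      (Pi.single j₀ (1 : ℂ)) (fun z hz hz' => by rw [hLu]; exact hsw₁ z hz hz')
      (fun z hz hz' b' => by rw [sum_proj_smulRight_apply]; exact Finset.sum_congr rfl fun k _ => by rw [hsw₂ z hz hz' k])
  have hFEloc : ∀ z ∈ U, 1 - z ∈ U' → ∀ j, ∑ k, cc' (1 - z) k * cc k z j = if j = j₀ then 1 else 0 := fun z hz hz' j => by
    have key := congr_fun (hFEvec z hz hz') j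
    rw [Finset.sum_apply] at key
    simpa only [Pi.smul_apply, smul_eq_mul, Pi.single_apply] using key
  -- §B identification of the ball coordinates with the global pieces on `U ∖ P`, `U′ ∖ P′` (★ FILE 0 §2; base point `3∕2 ∈ D_n`)
  have h32 : (((3 / 2 : ℝ)) : ℂ) ∈ Metric.ball (0 : ℂ) (n + 2) := by
    rw [mem_ball_zero_iff, Complex.norm_real, Real.norm_eq_abs, abs_of_pos (by norm_num : (0 : ℝ) < 3 / 2)]
    have h0 : (0 : ℝ) ≤ n := Nat.cast_nonneg n
    linarith
  have h32re : (1 : ℝ) < ((((3 / 2 : ℝ)) : ℂ)).re := by rw [Complex.ofReal_re]; norm_num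
  have hid : ∀ k j, ∀ z ∈ U, z ∉ P → cc k z j = qc k j z := fun k j =>
    eqOn_diff_of_eqOn_re_gt (f := fun z => cc k z j) hUo hUD hUcd (differentiableOn_pi.1 (hccd k) j) hPc (countable_of_codiscrete hPcd) hPre (fun z _ hz => hqa k j z hz) h32 h32re (hagree k j)
  have hid' : ∀ k, ∀ w ∈ U', w ∉ P' → cc' w k = qc' k w := fun k =>
    eqOn_diff_of_eqOn_re_gt (f := fun w => cc' w k) hU'o hU'D hU'cd (differentiableOn_pi.1 hcc'd k) hP'c (countable_of_codiscrete hP'cd) hP're (fun z _ hz => hq'a k z hz) h32 h32re (hagree' k)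
  -- §C a base point `z₀ ∈ U ∖ P` with `1 − z₀ ∈ U′ ∖ P′` (★ FILE 0 §3 at `½`)
  have hhalf : (((1 / 2 : ℝ)) : ℂ) ∈ Metric.ball (0 : ℂ) (n + 2) := by
    rw [mem_ball_zero_iff, Complex.norm_real, Real.norm_eq_abs, abs_of_pos (by norm_num : (0 : ℝ) < 1 / 2)]
    have h0 : (0 : ℝ) ≤ n := Nat.cast_nonneg n
    linarith
  have hhalf' : (1 : ℂ) - (((1 / 2 : ℝ)) : ℂ) = (((1 / 2 : ℝ)) : ℂ) := by push_cast; ring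
  obtain ⟨z₀, ⟨hz₀U, hz₀P⟩, h1z₀U, h1z₀P⟩ := exists_mem_and_sub_mem (U := U) (U' := U') (P := P) (P' := P') 1 ((((1 / 2 : ℝ)) : ℂ))
    (hUcd _ hhalf) (hPcd _) (by rw [hhalf']; exact hU'cd _ hhalf) (by rw [hhalf']; exact hP'cd _)
  -- §D the entrywise identity near `z₀`, then everywhere off `P ∪ (1 − P′)` (§1)
  intro z hz hz' j
  have hloc : ∀ᶠ s in 𝓝 z₀, ∑ k, qc' k (1 - s) * qc k j s = if j = j₀ then 1 else 0 := by
    have hc1 : ContinuousAt (fun s : ℂ => 1 - s) z₀ := (continuous_const.sub continuous_id).continuousAt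
    filter_upwards [hUo.mem_nhds hz₀U, hPc.isOpen_compl.mem_nhds hz₀P, hc1.eventually_mem (hU'o.mem_nhds h1z₀U),
      hc1.eventually_mem (hP'c.isOpen_compl.mem_nhds h1z₀P)] with s hsU hsP h1U h1P
    rw [← hFEloc s hsU h1U j]
    exact Finset.sum_congr rfl fun k _ => by rw [← hid k j s hsU hsP, ← hid' k (1 - s) h1U h1P]
  exact sum_mul_eq_of_eventually 1 (if j = j₀ then 1 else 0) (countable_of_codiscrete hPcd) (countable_of_codiscrete hP'cd) (fun k s hs => hqa k j s hs) hq'a hloc z hz hz'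

end Summit.HodgeConjecture.HodgeConjecture.Cruxes.H413.K2E1ChiScatteringMatrixFunctionalEquationCMTwoGlobal

end
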